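import Literature.AlgebraicGeometry.Hironaka2017.S16Proof.R020MainTheoremsIIIII
import Literature.AlgebraicGeometry.Resolution.KollarBlowupSequenceFunctors
import Literature.AlgebraicGeometry.Resolution.PrincipalizationToResolutionInChar
import Literature.AlgebraicGeometry.Resolution.SmoothOfRegularPerfectField
import Literature.AlgebraicGeometry.Resolution.SmoothStalksRegular
import Summits.ResolutionOfSingularities.ResolutionOfSingularities.Theorems.HironakaBridgeLinks
import HarnessLib

/-!
# Rung B, entry point P0 (OURS): the typed Main Theorem III of Hironaka 2017 (Th. 16.14, a CANDIDATE
# consumed as a hypothesis) implies Kollár-format principalization over every perfect field of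
# characteristic `p`, hence `PerfectRes p`, hence — modulo the crux `DescentPerfectToAll`
# (stmt-ResolutionOfSingularities-0549) — the summit statement

HONEST FRAMING (LADDER-RESOLUTION, D-0089 / D-0012). Nothing in this file asserts a statement of
H. Hironaka's 2017 manuscript. `Literature.AlgebraicGeometry.Hironaka2017.S16Proof.Thm16_14` (row 020
of the statements-first typing: «Given any ideal exponent `E` and any NC-data `Γ` in `Z` we have a
resolution of singularities of `E` by a finite sequence of blowups of `Z` permissible for `E` and `Γ`.
Here the resolution means to make the singular locus empty», p.87 l.30–34) is a `def … : Prop`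
tagged `[claim: Hironaka2017, status: under-review]`; here it only ever appears as an explicit
HYPOTHESIS `(h16 : Thm16_14)`. What is proved is an implication — kernel evidence for GAP-LEDGER row
R42 under reading RF-42-W («Th 16.14 for `E = (I_X·O_Z, 1)`, `Γ = ∅` is principalization of `I_X`»,
res-adj-8 2026-08-26T16:07:32Z / 16:17:21Z) and the content of the route-Descent support item
`HironakaBridgeIEResToPrincipalization` (stmt-ResolutionOfSingularities-19709, entry point P0 of
plan/RUNG-B.md v0.2). It also records that the typed `Thm16_14` is NOT vacuous in the sense asked by
the G8 lead (16:07:32Z: «Thm16_14 must EXPOSE centres (closed, smooth, ⊂ Sing(E_i)), the blow-up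
morphisms, the transform law Def 2.1 and the final Sing(E_r) = ∅»): all four are consumed below.

## The argument (every step a tree theorem; characteristic-free)

Fix a prime `p`, a perfect field `K` of characteristic `p`, a regular integral separated `K`-scheme
`s : P → Spec K` of finite type and a closed immersion `ι : X ↪ P` with `ι(X) ≠ P`
(the data of `Resolution.KollarPrincipalizationOver K`, Kollár 2007 Thm. 3.21 in the weak form the
tree consumes).
1. `P` is smooth over `K` (`smooth_of_isRegular_of_perfectField`: regular + locally of finite type
   over a perfect field) and irreducible (integral), so `(P, s)` is an ambient datum of the manuscript's
   §2 p.4 l.22–24 (`S02Preliminaries.AmbientDatum`, row 001).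
2. `E := (ι.ker, 1)` is an ideal exponent with `J ≠ (0)`, `b > 0` (`IdealExponent.IsStandard`;
   `ker_ne_bot_of_range_ne_univ`), and the empty NC-data `Γ = []` satisfies `IsNCData` on the regular
   `P` (`hasSNC_nil_of_isRegular`).
3. `h16` yields `σ : P' → P`, `E'`, `Γ'` with `IsPermissibleSeqNC s E [] σ E' Γ'` (row 020's
   carrier: finitely many blow-ups, each along the reduced ideal of a closed irreducible centre smooth
   over `K` inside `Sing` of the current transform and with normal crossings with the current
   NC-data; transforms by Def. 2.1 / Def. 2.3) and `Sing(E') = ∅`.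
4. `IsPermissibleSeqNC.isMultipleBlowup`: such a sequence IS a multiple blow-up of the marked ideal
   `(ι.ker, [], 1)` in the sense of Bierstone–Grigoriev–Milman–Włodarczyk / Kollár
   (`Resolution.IsMultipleBlowup`): the manuscript's Def. 2.1 transform (controlled transform
   `(J𝒪 : 𝓘(D)^b)`) and Def. 2.3 transform of NC-data (strict transforms, exceptional divisor last) are
   DEFINITIONALLY `Resolution.MarkedIdeal.transform`; `Sing(E) = supp(J, Γ, b)` definitionally (`support_markedIdeal_eq_sing`); a centre
   smooth over `K` is a regular scheme (`isRegularLocalRing_stalk_of_smooth_of_field`, Stacks 056S);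
   the support of the reduced ideal of a closed `D` is `D` (`coe_support_vanishingIdeal`).
5. Kollár's 3.72 with empty boundary, as formalised in `KollarOrderReduction.lean`
   (`IsMultipleBlowup.isRegularCentredSequence / isRegular / isIso_morphismRestrict /
   exists_comap_eq_mul`, `IsMarkedResolution.ideal_eq_top`,
   `isPrincipal_ker_stalkMap_of_isLocallyPrincipalAt`): the four clauses of
   `KollarPrincipalizationOver K`.
6. `KollarPrincipalizationOver.hasResolution` (Kollár Cor. 3.22 + Thm. 3.36 over the fixed field, Chow
   proved in the tree) gives `PerfectRes p` (HironakaBridge.lean); the `p`-slice `DescentAt p` of the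
   crux stmt-0549 then gives `ResolutionInChar p`, and over all primes `ResolutionOfSingularities`.

Consequence for the ladder (bookkeeping, not a claim about the manuscript): under reading RF-42-W the
chain «typed Th. 16.14 (hypothesis) + stmt-0549 (open crux) ⇒ summit» is kernel-checked with NO
further glue (neither G8-a `ERSToEmbeddedSmoothRes` nor B0/B1 is needed on this path).

## Sources

* H. Hironaka, ms. 2017-03-23, §2 p.4–5 (ambient convention, `Sing(E)`, permissibility, Def. 2.1,
  Def. 2.3), §16.3 p.87 l.30–36 (Th. 16.14). [Hironaka2017] (ADJUDICATED, consumed as hypothesis only)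
* J. Kollár, *Lectures on Resolution of Singularities* (2007), Thm. 3.21, Cor. 3.22, 3.72 (pp. 124–125,
  151–152). [Kollar2007]
* E. Bierstone, D. Grigoriev, P. Milman, J. Włodarczyk, arXiv:1206.3090, Def. 3.1.1–3.1.4, §3.3.
  [BierstoneGrigorievMilmanWlodarczyk2011]
* The Stacks Project, Tag 056S. [StacksProject]
-/

noncomputable section

open CategoryTheory CategoryTheory.Limits AlgebraicGeometry TopologicalSpace

set_option linter.dupNamespace false -- mandated namespace of this single-conjunct summit

namespace Summit.ResolutionOfSingularities.ResolutionOfSingularities.Theorems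

open Literature.AlgebraicGeometry.Resolution
open Literature.AlgebraicGeometry.Hironaka2017.S02Preliminaries
open Literature.AlgebraicGeometry.Hironaka2017.S16Proof

universe u

/-! ## Ideal exponents with NC-data as marked ideals (definitional dictionary) -/

section Dictionary

variable {K : Type u} [Field K] {Z : Scheme.{u}}

/-- **`Sing(E)` is the support of the marked ideal `(J, Γ, b)`** — both are `{ξ | b ≤ ord_ξ J}`
(§2.1 p.4 l.35–37 as typed in row 001 vs. BGMW Def. 3.1.2); definitional. [folklore] -/
theorem support_markedIdeal_eq_sing (E : IdealExponent Z) (Γ : List Z.IdealSheafData) :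
    (⟨E.J, Γ, E.b⟩ : MarkedIdeal Z).support = E.sing := rfl

/-- **Def. 2.1 + Def. 2.3 transforms ARE the marked-ideal transform**: transforming `E` by Def. 2.1
(controlled transform with exponent `b`, row 001 `IdealExponent.transform`) and `Γ` by Def. 2.3
(strict transforms of the members, exceptional divisor appended last, row 001 `ncTransform`) at a
blow-up `π` with closed centre `D` is, definitionally, `MarkedIdeal.transform π 𝓘_D` of `(J, Γ, b)`
(BGMW Def. 3.1.3 (3)–(5)). [folklore] -/
theorem transform_markedIdeal_eq (E : IdealExponent Z) (Γ : List Z.IdealSheafData) {Z' : Scheme.{u}}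
    (π : Z' ⟶ Z) (D : Closeds Z) :
    (⟨E.J, Γ, E.b⟩ : MarkedIdeal Z).transform π (Scheme.IdealSheafData.vanishingIdeal D) =
      (⟨(E.transform π D).J, ncTransform Γ π D, (E.transform π D).b⟩ : MarkedIdeal Z') := rfl

/-- **A closed centre smooth over a field is a regular scheme**: for a closed `D ⊆ Z` whose reduced
closed subscheme `V(𝓘_D)` is smooth over `Spec K` (through some `g : Z → Spec K`), `V(𝓘_D)` is
regular (Stacks 056S, tree `isRegularLocalRing_stalk_of_smooth_of_field`). [cite: StacksProject, Tag 056S] -/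
theorem isRegular_subscheme_of_smooth (g : Z ⟶ Spec (.of K)) (D : Closeds Z)
    (h : Smooth ((Scheme.IdealSheafData.vanishingIdeal D).subschemeι ≫ g)) :
    Scheme.IsRegular (Scheme.IdealSheafData.vanishingIdeal D).subscheme :=
  fun x => isRegularLocalRing_stalk_of_smooth_of_field
    ((Scheme.IdealSheafData.vanishingIdeal D).subschemeι ≫ g) x

/-- **A finite sequence of blow-ups permissible for `E` and `Γ` (row 020's `IsPermissibleSeqNC`, the
shape Th. 16.14 quantifies over) is a multiple blow-up of the marked ideal `(J, Γ, b)`**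
(`Resolution.IsMultipleBlowup`, BGMW Def. 3.1.3–3.1.4): each step blows up the reduced ideal `𝓘_D` of a
closed centre `D` which is smooth over `K` — hence `V(𝓘_D)` is a regular scheme —, contained in
`Sing(E_i) = supp(J_i, Γ_i, b)` (and `supp 𝓘_D = D`, `D` being closed), with normal crossings with
`Γ_i` (`IsPermissibleForNC = HasSNCWith Γ_i 𝓘_D`), and the transforms agree (`transform_markedIdeal_eq`).
Irreducibility of the centres is not used. [folklore] -/
theorem isMultipleBlowup_of_isPermissibleSeqNC {f : Z ⟶ Spec (.of K)} {E : IdealExponent Z}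
    {Γ : List Z.IdealSheafData} {Z' : Scheme.{u}} {σ : Z' ⟶ Z} {E' : IdealExponent Z'}
    {Γ' : List Z'.IdealSheafData} (h : IsPermissibleSeqNC f E Γ σ E' Γ') :
    IsMultipleBlowup (⟨E.J, Γ, E.b⟩ : MarkedIdeal Z) σ ⟨E'.J, Γ', E'.b⟩ := by
  induction h with
  | nil => exact IsMultipleBlowup.refl _
  | @blowup Z₁ Z₂ σ₁ E₁ Γ₁ h D π hπ hΓ ih =>
    obtain ⟨hbl, hcentre⟩ := hπ
    have hreg : Scheme.IsRegular (Scheme.IdealSheafData.vanishingIdeal D).subscheme :=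
      isRegular_subscheme_of_smooth (σ₁ ≫ f) D hcentre.smooth
    have hsupp : ((Scheme.IdealSheafData.vanishingIdeal D).support : Set Z₁) ⊆
        (⟨E₁.J, Γ₁, E₁.b⟩ : MarkedIdeal Z₁).support := by
      rw [Scheme.IdealSheafData.coe_support_vanishingIdeal, support_markedIdeal_eq_sing]
      exact hcentre.subset_sing
    have step := IsMultipleBlowup.blowup ih (Scheme.IdealSheafData.vanishingIdeal D) π hbl hreg hsupp hΓ
    rw [transform_markedIdeal_eq] at step
    exact step

end Dictionary

/-! ## P0: the typed Th. 16.14 (hypothesis) ⇒ Kollár-format principalization over perfect fields -/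

/-- **Entry point P0 of rung B (OURS; kernel evidence for GAP row R42, reading RF-42-W).** IF the typed
candidate `S16Proof.Thm16_14` (Hironaka 2017, Th. 16.14 = Main Theorem III, p.87 l.30–34: every ideal
exponent `E` with `J ≠ (0)`, `b > 0` and every NC-data `Γ` on a smooth irreducible `Z` of finite type
over a perfect field of characteristic `p` admit a finite sequence of blow-ups permissible for `E` and
`Γ` emptying `Sing(E)`) holds — it is CONSUMED AS A HYPOTHESIS, never asserted — THEN Kollár-format
principalization (`Resolution.KollarPrincipalizationOver K`, Kollár 2007 Thm. 3.21, weak form) holds over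
every perfect field `K` of characteristic `p`: apply the hypothesis to the ideal exponent `(I_X, 1)` with
empty NC-data on the regular (= smooth, `K` perfect) integral ambient `P`; the resulting sequence is a
multiple blow-up of the marked ideal `(I_X, ∅, 1)` with regular centres over `cosupp I_X = X`
(`isMultipleBlowup_of_isPermissibleSeqNC`), so Kollár's 3.72 argument (tree `KollarOrderReduction.lean`)
gives the four clauses: regular-centred proper sequence over `X`, regular `P'`, isomorphism off `X`,
and `Π^* I_X` locally principal («`I_r = 𝒪` since `Sing(I_r, 1) = ∅`»).
[cite: Kollar2007, Thm. 3.21 and 3.72 (pp. 124, 151–152)] -/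
theorem kollarPrincipalizationOver_of_thm16_14 (h16 : Thm16_14.{u}) (p : ℕ) [Fact p.Prime]
    (K : Type u) [Field K] [CharP K p] [PerfectField K] : KollarPrincipalizationOver.{u} K := by
  intro P s hsep hft hqc hint hP X ι _ hne
  haveI := hsep
  haveI := hft
  haveI := hqc
  haveI := hint
  haveI : IsLocallyNoetherian P := LocallyOfFiniteType.isLocallyNoetherian s
  have hsm : Smooth s := smooth_of_isRegular_of_perfectField s hP
  -- the ambient datum of §2 p.4 l.22–24 (row 001): `P` smooth irreducible of finite type over `K`
  let A : AmbientDatum p K := ⟨P, s, inferInstance, hsm, hqc⟩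
  -- the ideal exponent `(I_X, 1)` with empty NC-data
  let E : IdealExponent P := ⟨ι.ker, 1⟩
  have hE : E.IsStandard := ⟨ker_ne_bot_of_range_ne_univ ι hne, Nat.one_pos⟩
  have hΓ : IsNCData s ([] : List P.IdealSheafData) :=
    ⟨fun I hI => absurd hI List.not_mem_nil, hasSNC_nil_of_isRegular hP⟩
  -- Th. 16.14 (hypothesis) applied to `(P, (I_X, 1), ∅)`
  obtain ⟨P', Φ, E', Γ', hseq, hsing⟩ := h16 p K A E [] hE hΓ
  -- the marked ideals `(I_X, ∅, 1)` on `P` and `(J_r, Γ_r, 1)` on `P'`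
  let M : MarkedIdeal P := ⟨E.J, [], E.b⟩
  let M' : MarkedIdeal P' := ⟨E'.J, Γ', E'.b⟩
  have hmb : IsMultipleBlowup M Φ M' := isMultipleBlowup_of_isPermissibleSeqNC hseq
  have hres : IsMarkedResolution M Φ M' := ⟨hmb, hsing⟩
  have hsupp : (M.ideal.support : Set P) = Set.range ι := coe_support_ker_of_isClosedImmersion ι
  refine ⟨P', Φ, ?_, hmb.isRegular hP, ?_, ?_⟩
  · -- (3.21.3)/(3.21.2): a sequence of proper modifications with regular centres over `ι(X)`
    have := hmb.isRegularCentredSequence le_rfl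
    rwa [hsupp] at this
  · -- (3.21.2): an isomorphism over `P ∖ ι(X)`
    have hiso := hmb.isIso_morphismRestrict le_rfl
    have hU : complRange ι = ⟨(M.ideal.support : Set P)ᶜ, M.ideal.support.isClosed.isOpen_compl⟩ := by
      ext1
      change (Set.range ι)ᶜ = (M.ideal.support : Set P)ᶜ
      rw [hsupp]
    rw [hU]
    exact hiso
  · -- (3.21.1): `Φ^* I_X = 𝓔 · I_r = 𝓔` is locally principal, hence principal in every local ring
    intro e
    apply isPrincipal_ker_stalkMap_of_isLocallyPrincipalAt
    obtain ⟨F, hF, hEq⟩ := hmb.exists_comap_eq_mul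
    have htop : M'.ideal = ⊤ := hres.ideal_eq_top rfl
    rw [htop, Scheme.IdealSheafData.mul_top] at hEq
    rw [Scheme.IdealSheafData.ker_fst_of_isClosedImmersion]
    change IsLocallyPrincipalAt (M.ideal.comap Φ) _
    rw [hEq]
    exact hF _

/-! ## Consequences on the ladder: `PerfectRes p`, and the summit modulo stmt-0549 -/

/-- **The typed Th. 16.14 (hypothesis) gives resolution over every perfect field of characteristic
`p`** (`PerfectRes p` of HironakaBridge.lean = the antecedent of the `p`-slice of stmt-0549): Kollár's
Cor. 3.22 / Thm. 3.36 over the fixed field (`KollarPrincipalizationOver.hasResolution`: embedded case by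
the first regular centre through the generic point, Chow's lemma, components) applied to
`kollarPrincipalizationOver_of_thm16_14`. Nothing of the manuscript is asserted.
[cite: Kollar2007, Cor. 3.22 and Thm. 3.36 (pp. 124–125, 132)] -/
theorem perfectRes_of_thm16_14 (h16 : Thm16_14.{0}) {p : ℕ} (hp : p.Prime) : PerfectRes p := by
  haveI : Fact p.Prime := ⟨hp⟩
  intro k _ _ _ X f hsep hft hqc hred
  haveI := hsep
  haveI := hft
  haveI := hqc
  haveI := hred
  exact (kollarPrincipalizationOver_of_thm16_14 h16 p k).hasResolution X f

/-- Under the typed Th. 16.14 (hypothesis), `EmbeddedSmoothResPerfect p` — the consequence-shape the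
bridge's rung B starts from — holds as well (through `PerfectRes p`,
`embeddedSmoothResPerfect_of_perfectRes`). [folklore] -/
theorem embeddedSmoothResPerfect_of_thm16_14 (h16 : Thm16_14.{0}) {p : ℕ} (hp : p.Prime) :
    EmbeddedSmoothResPerfect p :=
  embeddedSmoothResPerfect_of_perfectRes (perfectRes_of_thm16_14 h16 hp)

/-- **The typed Th. 16.14 (hypothesis) and the `p`-slice `DescentAt p` of the crux stmt-0549 (hypothesis)
give the summit conjunct `ResolutionInChar p`.** [folklore] -/
theorem resolutionInChar_of_thm16_14_of_descentAt (h16 : Thm16_14.{0}) {p : ℕ} (hp : p.Prime)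
    (hd : DescentAt p) : ResolutionInChar.{0} p :=
  hd (perfectRes_of_thm16_14 h16 hp)

/-- **Reading RF-42-W of GAP row R42, kernel form, all the way to the summit**: the TYPED Main Theorem
III of the manuscript (`S16Proof.Thm16_14`, a candidate under adjudication, here a HYPOTHESIS) together
with the OPEN crux `Theses.Descent.DescentPerfectToAll` (stmt-ResolutionOfSingularities-0549, a
HYPOTHESIS) implies the summit statement `ResolutionOfSingularities`. No other glue enters (in particular
neither the §1 ERS sentence nor G8-a). This prices the path; it asserts nothing about the manuscript and
nothing about resolution in characteristic `p`. [folklore] -/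
theorem resolutionOfSingularities_of_thm16_14_of_descentPerfectToAll (h16 : Thm16_14.{0})
    (hd : Summit.ResolutionOfSingularities.ResolutionOfSingularities.Theses.Descent.DescentPerfectToAll) :
    _root_.ResolutionOfSingularities :=
  _root_.ResolutionOfSingularities_iff.mpr fun p hp =>
    resolutionInChar_of_thm16_14_of_descentAt h16 hp (descentPerfectToAll_iff.mp hd p hp)

/-! ## Item `HironakaBridgeIEResToPrincipalization` (stmt-ResolutionOfSingularities-19709): the closer -/

/-- **Route `Descent`, support item `HironakaBridgeIEResToPrincipalization` (stmt-ResolutionOfSingularities-19709,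
rung-B entry point P0), closed — the item's signature verbatim**: IF the typed candidate Th. 16.14 of Hironaka
2017 (`S16Proof.Thm16_14`, Main Theorem III; a HYPOTHESIS, never asserted) THEN Kollár-format principalization
holds over every perfect field of every prime characteristic `p` — the universe-`0` instance of
`kollarPrincipalizationOver_of_thm16_14`. OURS; nothing of the manuscript is asserted.
[cite: Kollar2007, Thm. 3.21 and 3.72 (pp. 124, 151–152)] -/
theorem hironakaBridgeIEResToPrincipalization_proof :
    Literature.AlgebraicGeometry.Hironaka2017.S16Proof.Thm16_14.{0} →
      ∀ (p : ℕ) [Fact (Nat.Prime p)] (K : Type) [Field K] [CharP K p] [PerfectField K],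
        Literature.AlgebraicGeometry.Resolution.KollarPrincipalizationOver.{0} K :=
  fun h16 p _ K _ _ _ => kollarPrincipalizationOver_of_thm16_14 h16 p K

end Summit.ResolutionOfSingularities.ResolutionOfSingularities.Theorems

end
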